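import Summits.MatrixMultiplication.OmegaCensus.BoxUsefulNormalThreeSubgroup

/-!
# ω-census, family (b3): conjecture C9 (b) — minimal normal `3`-subgroups: an element commuting with a Sylow `2`-subgroup modulo `C_G(V)` inverts or centralises `V`

HONEST FRAMING (pub-omega census; verbatim): lottery ticket; floor = certified bounds/negative ranges.
Census BOOKKEEPING (conjecture C9 of the cell, STRUCTURE.md §2; pub-omega kernel-l4 gen 16, task K-5, structure part; the
`p = 3` half of the centreless branch, second file).  Setting as in `BoxUsefulNormalThreeSubgroup`: `G` box-useful of order
`2^a 3^b`, `Z(G) = 1`, `V ⊴ G` minimal normal, elementary abelian `3`-group.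
* `TwoThree.inverts_or_centralizes` — for `g` with `⁅g, P⁆ ⊆ C_G(V)` (`P` a Sylow `2`-subgroup) and `g² ∈ C_G(V)` the set
  `{v · g v g⁻¹ : v ∈ V}` is a normal subgroup of `G` inside `V` (as `G = P · C_G(V)`) consisting of `g`-fixed elements; by
  minimality of `V` it is trivial (`g` inverts `V`) or all of `V` (`g` centralises `V`).  This is the tool for the successor's
  `cyclic_of_minimal_normal` (`|V| = 3`): if every `x ∈ P` has `x² ∈ C_G(V)` it applies to every `p ∈ P`, so every line of `V`
  is normal and `V` is a line; otherwise some `x ∈ P` with `x² ∉ C_G(V)`, `x⁴ ∈ C_G(V)` has `x²` acting as `-1` (fixed /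
  inverted lines are `x`-stable) and `(a, x)` is the `C₃² ⋊ C₄`-configuration (`C3C3C4Config`).
Nothing here is progress on `ω`.
-/

namespace Summit.MatrixMultiplication.OmegaCensus

open Finset ProductBoxBound
open scoped commutatorElement

namespace TwoThree

variable {G : Type*} [Group G] [Fintype G] [DecidableEq G]

omit [DecidableEq G] in
/-- The normal subgroup `{v · g v g⁻¹ : v ∈ V}` for `g` with `⁅g, P⁆ ⊆ C_G(V)` and `g² ∈ C_G(V)`; by minimality of `V`, `g`
inverts or centralises `V`. [folklore] -/
theorem inverts_or_centralizes (h23 : ∀ q : ℕ, q.Prime → q ∣ Fintype.card G → q = 2 ∨ q = 3) (V : Subgroup G)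
    [hVn : V.Normal] (hVab : ∀ v ∈ V, ∀ w ∈ V, v * w = w * v)
    (hVmin : ∀ W : Subgroup G, W.Normal → W ≤ V → W = ⊥ ∨ W = V) (P : Sylow 2 G)
    (hC3 : ∀ (t : G) (k : ℕ), t ^ 3 ^ k = 1 → t ∈ Subgroup.centralizer (V : Set G)) {g : G}
    (hgP : ∀ p ∈ (P : Subgroup G), g * p * g⁻¹ * p⁻¹ ∈ Subgroup.centralizer (V : Set G))
    (hg2 : g * g ∈ Subgroup.centralizer (V : Set G)) :
    (∀ v ∈ V, g * v * g⁻¹ = v⁻¹) ∨ (∀ v ∈ V, g * v * g⁻¹ = v) := by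
  classical
  set C := Subgroup.centralizer (V : Set G) with hC
  haveI : C.Normal := by rw [hC]; exact Subgroup.normal_centralizer
  have memC : ∀ x : G, x ∈ C ↔ ∀ v ∈ V, x * v = v * x := by
    intro x; rw [hC, Subgroup.mem_centralizer_iff]
    exact ⟨fun h v hv => (h v hv).symm, fun h v hv => (h v hv).symm⟩
  have hVconj : ∀ x v : G, v ∈ V → x * v * x⁻¹ ∈ V := fun x v hv => hVn.conj_mem v hv x
  let φ : G → G := fun v => v * (g * v * g⁻¹)
  have hφV : ∀ v ∈ V, φ v ∈ V := fun v hv => V.mul_mem hv (hVconj g v hv)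
  have hφmul : ∀ v ∈ V, ∀ w ∈ V, φ (v * w) = φ v * φ w := by
    intro v hv w hw
    change v * w * (g * (v * w) * g⁻¹) = v * (g * v * g⁻¹) * (w * (g * w * g⁻¹))
    have e1 : g * (v * w) * g⁻¹ = (g * v * g⁻¹) * (g * w * g⁻¹) := by group
    rw [e1]
    calc v * w * (g * v * g⁻¹ * (g * w * g⁻¹)) = v * (w * (g * v * g⁻¹)) * (g * w * g⁻¹) := by group
      _ = v * (g * v * g⁻¹ * w) * (g * w * g⁻¹) := by rw [hVab w hw (g * v * g⁻¹) (hVconj g v hv)]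
      _ = v * (g * v * g⁻¹) * (w * (g * w * g⁻¹)) := by group
  let W : Subgroup G :=
    { carrier := {x | ∃ v ∈ V, φ v = x}
      one_mem' := ⟨1, V.one_mem, by change (1 : G) * (g * 1 * g⁻¹) = 1; group⟩
      mul_mem' := by
        rintro x y ⟨v, hv, rfl⟩ ⟨w, hw, rfl⟩
        exact ⟨v * w, V.mul_mem hv hw, hφmul v hv w hw⟩
      inv_mem' := by
        rintro x ⟨v, hv, rfl⟩
        refine ⟨v⁻¹, V.inv_mem hv, ?_⟩
        have e := hφmul v⁻¹ (V.inv_mem hv) v hv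
        rw [inv_mul_cancel] at e
        have h1 : φ 1 = 1 := by change (1 : G) * (g * 1 * g⁻¹) = 1; group
        rw [h1] at e
        exact eq_inv_of_mul_eq_one_left e.symm }
  have hWV : W ≤ V := by rintro x ⟨v, hv, rfl⟩; exact hφV v hv
  have hWP : ∀ p ∈ (P : Subgroup G), ∀ x ∈ W, p * x * p⁻¹ ∈ W := by
    rintro p hp x ⟨v, hv, rfl⟩
    refine ⟨p * v * p⁻¹, hVconj p v hv, ?_⟩
    change p * v * p⁻¹ * (g * (p * v * p⁻¹) * g⁻¹) = p * (v * (g * v * g⁻¹)) * p⁻¹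
    calc p * v * p⁻¹ * (g * (p * v * p⁻¹) * g⁻¹)
        = p * v * p⁻¹ * ((g * p * g⁻¹ * p⁻¹) * (p * (g * v * g⁻¹) * p⁻¹) * (g * p * g⁻¹ * p⁻¹)⁻¹) := by group
      _ = p * v * p⁻¹ * ((p * (g * v * g⁻¹) * p⁻¹) * (g * p * g⁻¹ * p⁻¹) * (g * p * g⁻¹ * p⁻¹)⁻¹) := by
          rw [(memC _).1 (hgP p hp) _ (hVconj p _ (hVconj g v hv))]
      _ = p * (v * (g * v * g⁻¹)) * p⁻¹ := by group
  have hWC : ∀ c ∈ C, ∀ x ∈ W, c * x * c⁻¹ ∈ W := by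
    rintro c hc x ⟨v, hv, rfl⟩
    refine ⟨v, hv, ?_⟩
    rw [(memC c).1 hc (φ v) (hφV v hv)]; group
  haveI hWn : W.Normal := ⟨by
    intro x hx y
    obtain ⟨p, hp, c, hc, rfl⟩ := exists_mul_of_sylow_normal h23 P C hC3 y
    rw [mul_inv_rev, show p * c * x * (c⁻¹ * p⁻¹) = p * (c * x * c⁻¹) * p⁻¹ by group]
    exact hWP p hp _ (hWC c hc x hx)⟩
  rcases hVmin W hWn hWV with hbot | htop
  · left; intro v hv
    have : φ v ∈ W := ⟨v, hv, rfl⟩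
    rw [hbot, Subgroup.mem_bot] at this
    exact eq_inv_of_mul_eq_one_right this
  · right
    have hg2' : ∀ v ∈ V, g * g * v * (g * g)⁻¹ = v := fun v hv => by
      rw [(memC _).1 hg2 v hv]; group
    have hWfix : ∀ x ∈ W, g * x * g⁻¹ = x := by
      rintro x ⟨v, hv, rfl⟩
      change g * (v * (g * v * g⁻¹)) * g⁻¹ = v * (g * v * g⁻¹)
      calc g * (v * (g * v * g⁻¹)) * g⁻¹ = (g * v * g⁻¹) * (g * g * v * (g * g)⁻¹) := by group
        _ = (g * v * g⁻¹) * v := by rw [hg2' v hv]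
        _ = v * (g * v * g⁻¹) := hVab _ (hVconj g v hv) _ hv
    intro v hv
    have hvW : v ∈ W := by rw [htop]; exact hv
    exact hWfix v hvW

end TwoThree

end Summit.MatrixMultiplication.OmegaCensus
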